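import Mathlib
import HarnessLib
import Summits.Ventures.LatticeQCDFlow.Exactness.SphereLuscherConverse

/-!
# Lüscher's flow equation ⟺ infinitesimal trivialization on the lattice of site spheres, and the trivialization of every intermediate tilted measure by one and the same flow

HONEST FRAMING: exact (Metropolis-corrected) sampling algorithms for lattice gauge theory;
figures of merit are autocorrelation/cost numbers at stated couplings and volumes; no
continuum-physics claim.

Venture `LatticeQCDFlow` (cell pub-lqcd), topic `Exactness`; FANOUT row 7 (`s0-cpn-null`).  NEW WORK
of the cell over the tree's `Exactness/SphereLuscherTrivialization.lean` (this leg: the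
time-dependent covariance law and Lüscher's theorem at the horizon),
`Exactness/SphereLuscherConverse.lean` (this leg: the converse) and
`Exactness/SphereFlowTransportCovariance.lean` (constant residual ⇒ constant tilted mean); nothing
is cited as a fact.  Printed counterpart, NAMED ONLY: M. Lüscher, Commun. Math. Phys. 293 (2010)
899, §3.2 eqs. (3.4)–(3.9) (the flow equation as the differential form of the trivialization
condition).

* §1 **EVERY INTERMEDIATE TIME WITH ONE FLOW** (**`luscher_trivialization_of_le`**): with a fixed
  horizon `T` and the flow equation `𝓛_sG_s = S + C_s` on `Ω` for `s ∈ [0, c]`, `0 ≤ c ≤ |T| + 1`,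
  the SAME evolution maps `Φ = sphereTDFlow hG T` give `∫H(Φ_{0→c}ω)dπ̄ = ∫e^{−cS}H dπ̄/Z_c` for every
  `C¹` `H` — so under the equation on `[0, c₀]` every tilted measure `e^{−cS}π̄/Z_c`, `c ≤ c₀`, is the
  law of `Φ_{0→c}` under `π̄`.
* §2 **THE EQUIVALENCE** (**`luscher_equation_iff_stationary`**): for `S ∈ C¹`, `G` jointly `C²`
  with evolution maps `Φ = sphereTDFlow hG T`, and `c ≤ |T| + 1`, the following are equivalent:
  (a) for every `s ∈ [0, c]` the residual `𝓛_sG_s − S` is constant on `Ω` (Lüscher's equation);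
  (b) for every `s ∈ [0, c]`, every target time `c'` and every `C¹` observable `H`, the tilted mean
  `s' ↦ ⟨H∘Φ_{s'→c'}⟩_{s'}` is stationary at `s` — THE FLOW EQUATION IS EXACTLY INFINITESIMAL
  TRIVIALIZATION.

NOT CLAIMED: existence of solutions; anything quantitative.
-/

noncomputable section

namespace Summit.Ventures.LatticeQCDFlow.Exactness

open Function Set Metric MeasureTheory NormedSpace InnerProductSpace
open scoped RealInnerProductSpace Topology

variable {Λ : Type*} {E : Type*} [NormedAddCommGroup E] [InnerProductSpace ℝ E]
  [FiniteDimensional ℝ E] [Fintype Λ] [DecidableEq Λ] [MeasurableSpace E] [BorelSpace E]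
  [Nontrivial E] {G : ℝ → (Λ → E) → ℝ} {T : ℝ}

/-! ## §1 Every intermediate time with one flow -/

section Intermediate

/-- **A constant residual makes every transported tilted mean stationary** (the easy direction):
if `𝓛_{s₀}G_{s₀} − S` is constant on `Ω` and `|s₀| ≤ |T| + 1`, then for every `c'` and every `C¹`
`H`, `s ↦ ⟨H∘Φ_{s→c'}⟩_s` has derivative `0` at `s₀`. -/
theorem hasDerivAt_tiltedMean_zero_of_residual_const {S H : (Λ → E) → ℝ} (hS : ContDiff ℝ 1 S)
    (hG : ContDiff ℝ 2 fun q : ℝ × (Λ → E) => G q.1 q.2) (hH : ContDiff ℝ 1 H) (c' : ℝ) {s₀ C : ℝ}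
    (hs₀ : |s₀| ≤ |T| + 1)
    (hsol : ∀ ω : Λ → sphere (0 : E) 1,
      sphereLuscherL S s₀ (G s₀) (fun m => (ω m : E)) = S (fun m => (ω m : E)) + C) :
    HasDerivAt (fun s =>
        (∫ ω, Real.exp (-(s * S (fun m => ((ω : Λ → sphere (0 : E) 1) m : E)))) *
            H (sphereTDFlow hG T s c' (fun m => (ω m : E)))
              ∂Measure.pi (fun _ : Λ => uniformSphere (volume : Measure E))) /
          ∫ ω, Real.exp (-(s * S (fun m => ((ω : Λ → sphere (0 : E) 1) m : E))))
            ∂Measure.pi (fun _ : Λ => uniformSphere (volume : Measure E))) 0 s₀ := by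
  have h := hasDerivAt_tiltedMean_comp_sphereTDFlow hS hG hH c' hs₀ (T := T)
  refine h.congr_deriv ?_
  have hZ := integral_exp_neg_mul_pos (Λ := Λ) (E := E) hS.continuous s₀
  have hRω : ∀ ω : Λ → sphere (0 : E) 1,
      sphereLuscherL S s₀ (G s₀) (fun m => (ω m : E)) - S (fun m => (ω m : E)) = C := fun ω => by
    rw [hsol ω]; ring
  simp_rw [hRω]
  rw [integral_mul_const, integral_mul_const]
  field_simp
  ring

/-- **LÜSCHER'S THEOREM AT EVERY INTERMEDIATE TIME WITH ONE AND THE SAME FLOW.**  Horizon `T`,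
`S ∈ C¹`, `G` jointly `C²`, `0 ≤ c ≤ |T| + 1`.  If `𝓛_sG_s = S + C_s` on `Ω` for every `s ∈ [0, c]`,
then `∫H(Φ_{0→c}ω)dπ̄ = ∫e^{−cS}H dπ̄/Z_c` for every `C¹` `H`, `Φ = sphereTDFlow hG T`. -/
theorem luscher_trivialization_of_le {S H : (Λ → E) → ℝ} (hS : ContDiff ℝ 1 S)
    (hG : ContDiff ℝ 2 fun q : ℝ × (Λ → E) => G q.1 q.2) (hH : ContDiff ℝ 1 H) {c : ℝ} (hc : 0 ≤ c)
    (hcT : c ≤ |T| + 1) {C : ℝ → ℝ}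
    (hsol : ∀ s ∈ Icc 0 c, ∀ ω : Λ → sphere (0 : E) 1,
      sphereLuscherL S s (G s) (fun m => (ω m : E)) = S (fun m => (ω m : E)) + C s) :
    ∫ ω, H (sphereTDFlow hG T 0 c (fun m => ((ω : Λ → sphere (0 : E) 1) m : E)))
        ∂Measure.pi (fun _ : Λ => uniformSphere (volume : Measure E)) =
      (∫ ω, Real.exp (-(c * S (fun m => ((ω : Λ → sphere (0 : E) 1) m : E)))) * H (fun m => (ω m : E))
          ∂Measure.pi (fun _ : Λ => uniformSphere (volume : Measure E))) /
        ∫ ω, Real.exp (-(c * S (fun m => ((ω : Λ → sphere (0 : E) 1) m : E))))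
          ∂Measure.pi (fun _ : Λ => uniformSphere (volume : Measure E)) := by
  have hsol' : ∀ s ∈ Icc 0 c, ∀ ω : Λ → sphere (0 : E) 1,
      sphereLuscherL S s (fun z : Λ → E => (timeBump T : ℝ → ℝ) s * G s z) (fun m => (ω m : E)) =
        S (fun m => (ω m : E)) + C s := fun s hs ω => by
    have hs' : |s| ≤ |T| + 1 := by rw [abs_of_nonneg hs.1]; linarith [hs.2]
    rw [sphereLuscherL_timeBump_mul hG hs' ω, hsol s hs ω]
  have h := tiltedMean_comp_family_eq_of_residual_const (Ψ := fun s z => sphereTDFlow hG T s c z)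
    (Gs := fun s z => (timeBump T : ℝ → ℝ) s * G s z) hS hH (contDiff_sphereTDFlow_initial hG c)
    (contDiff_timeBump_mul hG) (continuous_siteGrad_timeBump_mul hG)
    (fun s ω => hasDerivAt_comp_sphereTDFlow_initial' hG (hH.differentiable one_ne_zero)
      (norm_sphereConfig_eq_one ω) c s) hsol' (s := c) ⟨hc, le_rfl⟩
  simp only [sphereTDFlow_self, zero_mul, neg_zero, Real.exp_zero, one_mul, integral_const,
    smul_eq_mul, mul_one, probReal_univ, div_one] at h
  exact h.symm

end Intermediate

/-! ## §2 The equivalence -/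

section Equivalence

/-- **LÜSCHER'S FLOW EQUATION ⟺ INFINITESIMAL TRIVIALIZATION.**  For `S ∈ C¹`, `G` jointly `C²` with
evolution maps `Φ = sphereTDFlow hG T`, and `c ≤ |T| + 1`: the residual `𝓛_sG_s − S` is
constant on `Ω` for every `s ∈ [0, c]` IF AND ONLY IF for every `s ∈ [0, c]`, every target time
`c'` and every `C¹` observable `H` the tilted mean `s' ↦ ⟨H∘Φ_{s'→c'}⟩_{s'}` is stationary at `s`. -/
theorem luscher_equation_iff_stationary {S : (Λ → E) → ℝ} (hS : ContDiff ℝ 1 S)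
    (hG : ContDiff ℝ 2 fun q : ℝ × (Λ → E) => G q.1 q.2) {c : ℝ} (hcT : c ≤ |T| + 1) :
    (∀ s ∈ Icc 0 c, ∃ C : ℝ, ∀ ω : Λ → sphere (0 : E) 1,
      sphereLuscherL S s (G s) (fun m => (ω m : E)) = S (fun m => (ω m : E)) + C) ↔
    (∀ s ∈ Icc 0 c, ∀ c' : ℝ, ∀ H : (Λ → E) → ℝ, ContDiff ℝ 1 H →
      HasDerivAt (fun s' =>
        (∫ ω, Real.exp (-(s' * S (fun m => ((ω : Λ → sphere (0 : E) 1) m : E)))) *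
            H (sphereTDFlow hG T s' c' (fun m => (ω m : E)))
              ∂Measure.pi (fun _ : Λ => uniformSphere (volume : Measure E))) /
          ∫ ω, Real.exp (-(s' * S (fun m => ((ω : Λ → sphere (0 : E) 1) m : E))))
            ∂Measure.pi (fun _ : Λ => uniformSphere (volume : Measure E))) 0 s) := by
  have hwin : ∀ s ∈ Icc (0 : ℝ) c, |s| ≤ |T| + 1 := fun s hs => by
    rw [abs_of_nonneg hs.1]; linarith [hs.2]
  constructor
  · intro h s hs c' H hH
    obtain ⟨C, hC⟩ := h s hs
    exact hasDerivAt_tiltedMean_zero_of_residual_const hS hG hH c' (hwin s hs) hC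
  · intro h s hs
    haveI : Nonempty (sphere (0 : E) 1) := (NormedSpace.sphere_nonempty.mpr zero_le_one).to_subtype
    have ω₀ : Λ → sphere (0 : E) 1 := fun _ => Classical.arbitrary _
    refine ⟨sphereLuscherL S s (G s) (fun m => (ω₀ m : E)) - S (fun m => (ω₀ m : E)), fun ω => ?_⟩
    have h1 := sphereLuscherL_sub_eq_of_forall_hasDerivAt_zero hS hG c (hwin s hs) (h s hs c) ω ω₀
    linarith

end Equivalence

end Summit.Ventures.LatticeQCDFlow.Exactness

end
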